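import Summits.AtomisticToContinuum.Crystallization.Theorems.MinMeanCycleStackingLockLockedPhaseDefectBoundCycles

/-!
# Route `MinMeanCycleStackingLock`, item stmt-AtomisticToContinuum-12024 `LockedPhaseDefectBound` —
# part 2/3: the three finite-volume estimates

Helper file (lands `--supports stmt-AtomisticToContinuum-12024`).  For a sequence `s`, a window
length `L+1`, a certificate set `E` and `b = #{m < n : window_m(s) ∉ E}`:

* `trunc_sum_lower_bound` (finite range, telescoping of the node potentials `u`):
  `Σ_{m<n} haggLocalEnergyTrunc (L+1) J s m ≥ n·λ + g·b − 2·Σ_y |u y|` for Hägg `s`;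
* `orbit_sum_lower_bound` (cycle corrector `F = τ + v − v∘σ`, `τ ≥ Tm`, `|v| ≤ V`):
  `Σ_{good m<n} F(window_m) ≥ n·Tm − b·(t₀ + 2V) − 3V`;
* `tail_sum_lower_bound` (local comparison with the followed cycle + `card_obstructed_le`):
  `Σ_{m<n} tail_m(s) ≥ Σ_{good m<n} F(window_m) − b·(t₀ + t₁) − t₁`,
  where `t₀ = Σ_{k>L+1} |J_k|`, `t₁ = Σ_{k>L+1} k|J_k|`.
-/

namespace Summit.AtomisticToContinuum.Crystallization.Theorems

open Finset Filter Literature.MathematicalPhysics.StatisticalMechanics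
open scoped Topology

namespace LockedPhaseDefect

/-! ## The finite-range part: telescoping the node potentials -/

/-- **Finite-range Peierls estimate.** Summing the certificate slack over the windows at
`0, …, n-1` of a Hägg sequence telescopes the node potentials:
`H^{L+1}_n(s) ≥ n·λ + g·#{bad windows} − 2·max|u|`. -/
theorem trunc_sum_lower_bound (J : ℕ → ℝ) (L : ℕ) (E : Finset (Fin (L + 1) → ℤ))
    (u : (Fin L → ℤ) → ℝ) (lam g : ℝ)
    (hzero : ∀ x ∈ E, (∀ i, x i = 1 ∨ x i = -1) ∧ (∑ k ∈ Finset.Icc 2 (L + 1),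
      if (∑ i : Fin (L + 1), if (i : ℕ) < k then x i else 0) % 3 = 0 then J k else 0) - lam +
      u (fun i : Fin L => x (Fin.castSucc i)) - u (fun i : Fin L => x (Fin.succ i)) = 0)
    (hgap : ∀ x : Fin (L + 1) → ℤ, (∀ i, x i = 1 ∨ x i = -1) → x ∉ E → g ≤
      (∑ k ∈ Finset.Icc 2 (L + 1), if (∑ i : Fin (L + 1), if (i : ℕ) < k then x i else 0) % 3 = 0
        then J k else 0) - lam + u (fun i : Fin L => x (Fin.castSucc i)) -
        u (fun i : Fin L => x (Fin.succ i)))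
    (s : ℤ → ℤ) (hs : IsHaggSeq s) (n : ℕ) :
    (n : ℝ) * lam + g * (((Finset.range n).filter (fun m : ℕ =>
        (fun i : Fin (L + 1) => s ((m : ℤ) + ((i : ℕ) : ℤ))) ∉ E)).card : ℝ)
      - 2 * (∑ y ∈ Fintype.piFinset (fun _ : Fin L => ({1, -1} : Finset ℤ)), |u y|)
      ≤ ∑ m ∈ Finset.range n, haggLocalEnergyTrunc (L + 1) J s m := by
  -- prefixes of the windows
  set pre : ℕ → (Fin L → ℤ) := fun m i => s ((m : ℤ) + ((i : ℕ) : ℤ)) with hpre_def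
  set Mu := ∑ y ∈ Fintype.piFinset (fun _ : Fin L => ({1, -1} : Finset ℤ)), |u y| with hMu
  -- per-window slack inequality
  have key : ∀ m : ℕ, (if (fun i : Fin (L + 1) => s ((m : ℤ) + ((i : ℕ) : ℤ))) ∉ E then g else 0)
      ≤ haggLocalEnergyTrunc (L + 1) J s m - lam + u (pre m) - u (pre (m + 1)) := by
    intro m
    set x : Fin (L + 1) → ℤ := fun i => s ((m : ℤ) + ((i : ℕ) : ℤ)) with hx
    have hx1 : ∀ i, x i = 1 ∨ x i = -1 := fun i => hs _
    have e1 : (∑ k ∈ Icc 2 (L + 1), if (∑ i : Fin (L + 1), if (i : ℕ) < k then x i else 0)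
        % 3 = 0 then J k else 0) = haggLocalEnergyTrunc (L + 1) J s m :=
      cert_energy_eq_haggLocalEnergyTrunc J L s m
    have e2 : (fun i : Fin L => x (Fin.castSucc i)) = pre m := by
      funext i; simp [hx, hpre_def]
    have e3 : (fun i : Fin L => x (Fin.succ i)) = pre (m + 1) := by
      funext i
      simp only [hx, hpre_def, Fin.val_succ]
      congr 1
      push_cast
      ring
    by_cases hmem : x ∈ E
    · have h := (hzero x hmem).2
      rw [e1, e2, e3] at h
      rw [if_neg (not_not.mpr hmem)]
      linarith
    · have h := hgap x hx1 hmem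
      rw [e1, e2, e3] at h
      rw [if_pos hmem]
      linarith
  -- telescoping sum of the right-hand sides
  have htel : ∀ n : ℕ, ∑ m ∈ range n, (haggLocalEnergyTrunc (L + 1) J s m - lam + u (pre m)
      - u (pre (m + 1))) = ∑ m ∈ range n, haggLocalEnergyTrunc (L + 1) J s m - n * lam
      + u (pre 0) - u (pre n) := by
    intro n
    induction n with
    | zero => simp
    | succ n ih =>
      rw [sum_range_succ, sum_range_succ, ih]
      push_cast
      ring
  -- the left-hand sides sum to g · #bad
  have hbad : ∑ m ∈ range n, (if (fun i : Fin (L + 1) => s ((m : ℤ) + ((i : ℕ) : ℤ))) ∉ E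
      then g else 0) = g * (((Finset.range n).filter (fun m : ℕ =>
        (fun i : Fin (L + 1) => s ((m : ℤ) + ((i : ℕ) : ℤ))) ∉ E)).card : ℝ) := by
    rw [← sum_filter, sum_const, nsmul_eq_mul, mul_comm]
  have hsum := sum_le_sum fun m (_ : m ∈ range n) => key m
  rw [hbad, htel] at hsum
  have h0 : |u (pre 0)| ≤ Mu := abs_apply_le_sum_abs u (prefix_mem_piFinset s hs _)
  have hn : |u (pre n)| ≤ Mu := abs_apply_le_sum_abs u (prefix_mem_piFinset s hs _)
  rw [abs_le] at h0 hn
  linarith [h0.1, h0.2, hn.1, hn.2]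

/-! ## The orbit-average part: a corrector telescopes along followed stretches -/

/-- Consecutive windows in `E` are related by the successor map. -/
theorem window_succ_eq_sigma {L : ℕ} {E : Finset (Fin (L + 1) → ℤ)}
    (hpre : ∀ x ∈ E, ∀ y ∈ E, (fun i : Fin L => x (Fin.castSucc i)) =
      (fun i : Fin L => y (Fin.castSucc i)) → x = y)
    (σ : E → E) (hσ : ∀ (x : E) (i : Fin L), (σ x).1 (Fin.castSucc i) = x.1 (Fin.succ i))
    (s : ℤ → ℤ) (m : ℤ) (h : (fun i : Fin (L + 1) => s (m + ((i : ℕ) : ℤ))) ∈ E)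
    (h' : (fun i : Fin (L + 1) => s (m + 1 + ((i : ℕ) : ℤ))) ∈ E) :
    (⟨_, h'⟩ : E) = σ ⟨_, h⟩ := by
  apply Subtype.ext
  apply hpre _ h' _ (σ ⟨_, h⟩).2
  funext i
  rw [hσ]
  simp only [Fin.val_castSucc, Fin.val_succ]
  push_cast
  ring_nf

/-- **Orbit-average estimate.** If `F = τ + v - v ∘ σ` on `E` with `τ ≥ Tm`, then the sum of
`F` over the good windows among `0, …, n-1` is at least `n·Tm` up to a price per bad window and a
boundary constant. -/
theorem orbit_sum_lower_bound {L : ℕ} {E : Finset (Fin (L + 1) → ℤ)}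
    (hpre : ∀ x ∈ E, ∀ y ∈ E, (fun i : Fin L => x (Fin.castSucc i)) =
      (fun i : Fin L => y (Fin.castSucc i)) → x = y)
    (σ : E → E) (hσ : ∀ (x : E) (i : Fin L), (σ x).1 (Fin.castSucc i) = x.1 (Fin.succ i))
    (F τ v : E → ℝ) (Tm V t0 : ℝ)
    (hF : ∀ x, F x = τ x + v x - v (σ x)) (hTm : ∀ x, Tm ≤ τ x) (hTm' : |Tm| ≤ t0)
    (hV : ∀ x, |v x| ≤ V) (hV0 : 0 ≤ V) (s : ℤ → ℤ) (n : ℕ) :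
    (n : ℝ) * Tm - (((Finset.range n).filter (fun m : ℕ =>
        (fun i : Fin (L + 1) => s ((m : ℤ) + ((i : ℕ) : ℤ))) ∉ E)).card : ℝ) * (t0 + 2 * V)
      - 3 * V ≤ ∑ m ∈ Finset.range n,
        (if h : (fun i : Fin (L + 1) => s ((m : ℤ) + ((i : ℕ) : ℤ))) ∈ E then F ⟨_, h⟩ else 0) := by
  -- corrector potential and bad-window indicator along the sequence
  set Φ : ℕ → ℝ := fun m =>
    if h : (fun i : Fin (L + 1) => s ((m : ℤ) + ((i : ℕ) : ℤ))) ∈ E then v ⟨_, h⟩ else 0 with hΦ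
  set bad : ℕ → ℝ := fun m =>
    if (fun i : Fin (L + 1) => s ((m : ℤ) + ((i : ℕ) : ℤ))) ∉ E then 1 else 0 with hbad
  have hΦle : ∀ m, |Φ m| ≤ V := by
    intro m
    simp only [hΦ]
    split_ifs with h
    · exact hV _
    · simp [hV0]
  -- per-position inequality
  have key : ∀ m : ℕ, Tm - (Tm + V) * bad m - V * bad (m + 1) + (Φ m - Φ (m + 1)) ≤
      (if h : (fun i : Fin (L + 1) => s ((m : ℤ) + ((i : ℕ) : ℤ))) ∈ E then F ⟨_, h⟩ else 0) := by
    intro m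
    have hcast : ((m + 1 : ℕ) : ℤ) = (m : ℤ) + 1 := by push_cast; ring
    by_cases hm : (fun i : Fin (L + 1) => s ((m : ℤ) + ((i : ℕ) : ℤ))) ∈ E
    · by_cases hm1 : (fun i : Fin (L + 1) => s (((m + 1 : ℕ) : ℤ) + ((i : ℕ) : ℤ))) ∈ E
      · -- good, good: the next window is σ of this one
        have hm1' : (fun i : Fin (L + 1) => s ((m : ℤ) + 1 + ((i : ℕ) : ℤ))) ∈ E := by
          rw [hcast] at hm1; exact hm1
        have hsx : (⟨_, hm1'⟩ : E) = σ ⟨_, hm⟩ := window_succ_eq_sigma hpre σ hσ s m hm hm1'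
        have hΦm : Φ m = v ⟨_, hm⟩ := by simp only [hΦ]; rw [dif_pos hm]
        have hΦm1 : Φ (m + 1) = v (σ ⟨_, hm⟩) := by
          simp only [hΦ]; rw [dif_pos hm1, ← hsx]; congr 1
        have hb : bad m = 0 := by simp only [hbad]; rw [if_neg (not_not.mpr hm)]
        have hb1 : bad (m + 1) = 0 := by simp only [hbad]; rw [if_neg (not_not.mpr hm1)]
        rw [dif_pos hm, hF, hΦm, hΦm1, hb, hb1]
        linarith [hTm ⟨_, hm⟩]
      · -- good, bad
        have hΦm : Φ m = v ⟨_, hm⟩ := by simp only [hΦ]; rw [dif_pos hm]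
        have hΦm1 : Φ (m + 1) = 0 := by simp only [hΦ]; rw [dif_neg hm1]
        have hb : bad m = 0 := by simp only [hbad]; rw [if_neg (not_not.mpr hm)]
        have hb1 : bad (m + 1) = 1 := by simp only [hbad]; rw [if_pos hm1]
        rw [dif_pos hm, hF, hΦm, hΦm1, hb, hb1]
        have := hV (σ ⟨_, hm⟩)
        rw [abs_le] at this
        linarith [hTm ⟨_, hm⟩, this.1]
    · have hΦm : Φ m = 0 := by simp only [hΦ]; rw [dif_neg hm]
      have hb : bad m = 1 := by simp only [hbad]; rw [if_pos hm]
      rw [dif_neg hm, hΦm, hb]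
      have h1 := hΦle (m + 1)
      rw [abs_le] at h1
      have hb1 : 0 ≤ bad (m + 1) := by simp only [hbad]; split_ifs <;> norm_num
      nlinarith [h1.1, h1.2, hb1, hV0]
  -- sum the per-position inequalities
  have htel : ∀ n : ℕ, ∑ m ∈ range n, (Tm - (Tm + V) * bad m - V * bad (m + 1) + (Φ m - Φ (m + 1)))
      = n * Tm - (Tm + V) * ∑ m ∈ range n, bad m - V * ∑ m ∈ range n, bad (m + 1)
        + (Φ 0 - Φ n) := by
    intro n
    induction n with
    | zero => simp
    | succ n ih =>
      rw [sum_range_succ, sum_range_succ, sum_range_succ, ih]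
      push_cast
      ring
  have hsum := sum_le_sum fun m (_ : m ∈ range n) => key m
  rw [htel] at hsum
  -- identify / bound the indicator sums
  have hb : ∑ m ∈ range n, bad m = (((Finset.range n).filter (fun m : ℕ =>
        (fun i : Fin (L + 1) => s ((m : ℤ) + ((i : ℕ) : ℤ))) ∉ E)).card : ℝ) := by
    simp only [hbad]
    rw [Finset.sum_boole]
  have hbad01 : ∀ m, 0 ≤ bad m ∧ bad m ≤ 1 := by
    intro m; simp only [hbad]; split_ifs <;> norm_num
  have hb' : ∑ m ∈ range n, bad (m + 1) ≤ (∑ m ∈ range n, bad m) + 1 := by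
    have e : ∑ m ∈ range (n + 1), bad m = ∑ m ∈ range n, bad (m + 1) + bad 0 :=
      sum_range_succ' _ _
    rw [sum_range_succ] at e
    linarith [(hbad01 0).1, (hbad01 n).2]
  have hbn : 0 ≤ ∑ m ∈ range n, bad (m + 1) := sum_nonneg fun m _ => (hbad01 _).1
  have h0 := hΦle 0
  have hn := hΦle n
  rw [abs_le] at h0 hn hTm'
  set b := (((Finset.range n).filter (fun m : ℕ =>
        (fun i : Fin (L + 1) => s ((m : ℤ) + ((i : ℕ) : ℤ))) ∉ E)).card : ℝ) with hb_def
  have hbnn : 0 ≤ b := by rw [hb_def]; exact Nat.cast_nonneg _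
  rw [hb] at hsum hb'
  have h1 : Tm * b ≤ t0 * b := by nlinarith [hTm'.2]
  nlinarith [hsum, hb', hbn, h0.1, h0.2, hn.1, hn.2, hV0, hbnn, h1]

/-! ## The tail part: local comparison with the followed cycle -/

/-- **Counting obstructed positions.** For a range `k > L+1`, the positions `m < n` whose
look-ahead stretch `m+1, …, m+(k-L-1)` hits a bad window or the boundary `n` number at most
`(#bad + 1)·(k-L-1)`. -/
theorem card_obstructed_le {L : ℕ} (E : Finset (Fin (L + 1) → ℤ)) (s : ℤ → ℤ) (n k : ℕ)
    (hk : L + 1 < k) :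
    ((Finset.range n).filter (fun m : ℕ => ¬ ∀ j ∈ Finset.Icc 1 (k - (L + 1)),
        m + j < n ∧ (fun i : Fin (L + 1) => s (((m + j : ℕ) : ℤ) + ((i : ℕ) : ℤ))) ∈ E)).card
      ≤ (((Finset.range n).filter (fun m : ℕ =>
        (fun i : Fin (L + 1) => s ((m : ℤ) + ((i : ℕ) : ℤ))) ∉ E)).card + 1) * (k - (L + 1)) := by
  set D := k - (L + 1) with hD
  set Bad := (Finset.range n).filter (fun m : ℕ =>
        (fun i : Fin (L + 1) => s ((m : ℤ) + ((i : ℕ) : ℤ))) ∉ E) with hBad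
  have hsub : (Finset.range n).filter (fun m : ℕ => ¬ ∀ j ∈ Finset.Icc 1 D,
        m + j < n ∧ (fun i : Fin (L + 1) => s (((m + j : ℕ) : ℤ) + ((i : ℕ) : ℤ))) ∈ E)
      ⊆ (insert n Bad).biUnion (fun b => Finset.Icc (b - D) (b - 1)) := by
    intro m hm
    rw [mem_filter, mem_range] at hm
    obtain ⟨hmn, hobs⟩ := hm
    push Not at hobs
    obtain ⟨j, hj, hj'⟩ := hobs
    rw [mem_Icc] at hj
    rw [mem_biUnion]
    by_cases hlt : m + j < n
    · refine ⟨m + j, mem_insert_of_mem ?_, mem_Icc.mpr ⟨by omega, by omega⟩⟩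
      exact mem_filter.mpr ⟨mem_range.mpr hlt, hj' hlt⟩
    · exact ⟨n, mem_insert_self _ _, mem_Icc.mpr ⟨by omega, by omega⟩⟩
  refine (card_le_card hsub).trans (card_biUnion_le.trans ?_)
  calc ∑ b ∈ insert n Bad, (Finset.Icc (b - D) (b - 1)).card
      ≤ ∑ _b ∈ insert n Bad, D := sum_le_sum fun b _ => by
          rw [Nat.card_Icc]; omega
    _ = (insert n Bad).card * D := by rw [sum_const, smul_eq_mul]
    _ ≤ (Bad.card + 1) * D := Nat.mul_le_mul_right _ (card_insert_le _ _)

/-- Termwise comparison of two `J_k`-indicators: they differ by at most `|J_k|`. -/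
theorem ite_sub_abs_le_ite (a : ℝ) (P Q : Prop) [Decidable P] [Decidable Q] :
    (if P then a else 0) - |a| ≤ (if Q then a else 0) := by
  split_ifs <;> simp [le_abs_self, neg_abs_le, abs_nonneg]

/-- **Tail comparison.** The tail energy `Σ_{m<n} Σ_{k>L+1} J_k 1[aligned]` of `s` is at least
the sum over the good windows of the ideal tail energy `F` of the followed cycle, up to
`#bad·(t₀ + t₁) + t₁` with `t₀ = Σ_{k>L+1}|J_k|`, `t₁ = Σ_{k>L+1} k|J_k|`. -/
theorem tail_sum_lower_bound {L : ℕ} {E : Finset (Fin (L + 1) → ℤ)} (J : ℕ → ℝ)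
    (hJ : Summable fun k : ℕ => (k : ℝ) * |J k|)
    (hpre : ∀ x ∈ E, ∀ y ∈ E, (fun i : Fin L => x (Fin.castSucc i)) =
      (fun i : Fin L => y (Fin.castSucc i)) → x = y)
    (σ : E → E) (hσ : ∀ (x : E) (i : Fin L), (σ x).1 (Fin.castSucc i) = x.1 (Fin.succ i))
    (F : E → ℝ) (hFdef : ∀ x : E, F x =
      ∑' k : ℕ, if L + 1 < k ∧ (∑ t ∈ range k, (σ^[t] x).1 0) % 3 = 0 then J k else 0)
    (s : ℤ → ℤ) (n : ℕ) :
    ∑ m ∈ Finset.range n,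
        (if h : (fun i : Fin (L + 1) => s ((m : ℤ) + ((i : ℕ) : ℤ))) ∈ E then F ⟨_, h⟩ else 0)
      - (((Finset.range n).filter (fun m : ℕ =>
          (fun i : Fin (L + 1) => s ((m : ℤ) + ((i : ℕ) : ℤ))) ∉ E)).card : ℝ)
        * ((∑' k : ℕ, if L + 1 < k then |J k| else 0)
          + (∑' k : ℕ, if L + 1 < k then (k : ℝ) * |J k| else 0))
      - (∑' k : ℕ, if L + 1 < k then (k : ℝ) * |J k| else 0)
      ≤ ∑ m ∈ Finset.range n, ∑' k : ℕ, if L + 1 < k ∧ HaggAligned s m k then J k else 0 := by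
  have hJa : Summable fun k => |J k| := summable_abs_of_summable_mul_abs hJ
  set t0 := ∑' k : ℕ, if L + 1 < k then |J k| else 0 with ht0
  set t1 := ∑' k : ℕ, if L + 1 < k then (k : ℝ) * |J k| else 0 with ht1
  set Bad := (Finset.range n).filter (fun m : ℕ =>
        (fun i : Fin (L + 1) => s ((m : ℤ) + ((i : ℕ) : ℤ))) ∉ E) with hBad
  -- obstruction of the look-ahead stretch of length k - (L+1) at m
  set obs : ℕ → ℕ → Prop := fun m k => ¬ ∀ j ∈ Finset.Icc 1 (k - (L + 1)),
        m + j < n ∧ (fun i : Fin (L + 1) => s (((m + j : ℕ) : ℤ) + ((i : ℕ) : ℤ))) ∈ E with hobs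
  set cost : ℕ → ℕ → ℝ := fun m k =>
    if (fun i : Fin (L + 1) => s ((m : ℤ) + ((i : ℕ) : ℤ))) ∈ E ∧ L + 1 < k ∧ obs m k
      then |J k| else 0 with hcost
  set bad : ℕ → ℝ := fun m =>
    if (fun i : Fin (L + 1) => s ((m : ℤ) + ((i : ℕ) : ℤ))) ∉ E then 1 else 0 with hbad
  have hcost_le : ∀ m k, ‖cost m k‖ ≤ |J k| := by
    intro m k; simp only [hcost]; split_ifs <;> simp
  have hcost_sum : ∀ m, Summable (cost m) := fun m => Summable.of_norm_bounded hJa (hcost_le m)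
  -- per-position inequality
  have key : ∀ m : ℕ,
      (if h : (fun i : Fin (L + 1) => s ((m : ℤ) + ((i : ℕ) : ℤ))) ∈ E then F ⟨_, h⟩ else 0)
        - (∑' k, cost m k) - t0 * bad m
        ≤ ∑' k : ℕ, if L + 1 < k ∧ HaggAligned s m k then J k else 0 := by
    intro m
    by_cases hm : (fun i : Fin (L + 1) => s ((m : ℤ) + ((i : ℕ) : ℤ))) ∈ E
    · -- good window: compare termwise with the followed cycle
      have hb : bad m = 0 := by simp only [hbad]; rw [if_neg (not_not.mpr hm)]
      rw [dif_pos hm, hb, mul_zero, sub_zero, hFdef, ← Summable.tsum_sub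
        (summable_ite_of_summable_abs hJa _) (hcost_sum m)]
      refine Summable.tsum_le_tsum (fun k => ?_)
        ((summable_ite_of_summable_abs hJa _).sub (hcost_sum m))
        (summable_ite_of_summable_abs hJa _)
      by_cases hL : L + 1 < k
      · by_cases ho : obs m k
        · have hc : cost m k = |J k| := by simp only [hcost]; rw [if_pos ⟨hm, hL, ho⟩]
          rw [hc]
          exact ite_sub_abs_le_ite _ _ _
        · -- unobstructed: the windows m, …, m + (k - L - 1) are all good
          have hc : cost m k = 0 := by
            simp only [hcost]; rw [if_neg (fun h => ho h.2.2)]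
          have ho' : ∀ j ∈ Finset.Icc 1 (k - (L + 1)), m + j < n ∧
              (fun i : Fin (L + 1) => s (((m + j : ℕ) : ℤ) + ((i : ℕ) : ℤ))) ∈ E := by
            simp only [hobs] at ho; push Not at ho; exact ho
          have hgood : ∀ j : ℕ, j ≤ k - (L + 1) →
              (fun i : Fin (L + 1) => s ((m : ℤ) + (j : ℤ) + ((i : ℕ) : ℤ))) ∈ E := by
            intro j hj
            rcases Nat.eq_zero_or_pos j with rfl | hjpos
            · simpa using hm
            · have h2 := (ho' j (mem_Icc.mpr ⟨hjpos, hj⟩)).2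
              have e : ((m + j : ℕ) : ℤ) = (m : ℤ) + (j : ℤ) := by push_cast; ring
              rw [e] at h2
              exact h2
          have hw := haggWindow_eq_orbit_sum σ hσ hpre s m (k - (L + 1)) ⟨_, hm⟩ rfl hgood k
            (by omega)
          rw [hc, sub_zero]
          unfold HaggAligned
          rw [hw]
      · rw [if_neg (fun h => hL h.1), if_neg (fun h => hL h.1)]
        have hc : cost m k = 0 := by simp only [hcost]; rw [if_neg (fun h => hL h.2.1)]
        rw [hc]; simp
    · -- bad window: the crude bound -t₀
      have hb : bad m = 1 := by simp only [hbad]; rw [if_pos hm]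
      have hc : ∀ k, cost m k = 0 := by
        intro k; simp only [hcost]; rw [if_neg (fun h => hm h.1)]
      rw [dif_neg hm, hb, tsum_congr hc, tsum_zero]
      simpa using neg_tail_le hJa L s m
  -- sum over positions
  have hsum := sum_le_sum fun m (_ : m ∈ range n) => key m
  rw [sum_sub_distrib, sum_sub_distrib, ← mul_sum] at hsum
  have hb : ∑ m ∈ range n, bad m = (Bad.card : ℝ) := by
    simp only [hbad, hBad]
    rw [Finset.sum_boole]
  rw [hb] at hsum
  -- exchange the sums in the obstruction cost and count
  have hexch : ∑ m ∈ range n, ∑' k, cost m k = ∑' k, ∑ m ∈ range n, cost m k :=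
    (Summable.tsum_finsetSum (fun m _ => hcost_sum m)).symm
  have hcount : ∀ k, ∑ m ∈ range n, cost m k ≤
      if L + 1 < k then ((Bad.card : ℝ) + 1) * ((k : ℝ) * |J k|) else 0 := by
    intro k
    by_cases hL : L + 1 < k
    · rw [if_pos hL]
      have e : ∑ m ∈ range n, cost m k = (((range n).filter (fun m : ℕ =>
          (fun i : Fin (L + 1) => s ((m : ℤ) + ((i : ℕ) : ℤ))) ∈ E ∧ L + 1 < k ∧ obs m k)).card
            : ℝ) * |J k| := by
        simp only [hcost]
        rw [← sum_filter, sum_const, nsmul_eq_mul]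
      rw [e]
      have hc1 : ((range n).filter (fun m : ℕ =>
          (fun i : Fin (L + 1) => s ((m : ℤ) + ((i : ℕ) : ℤ))) ∈ E ∧ L + 1 < k ∧ obs m k)).card
          ≤ ((range n).filter (fun m : ℕ => obs m k)).card :=
        card_le_card fun m hm => by
          rw [mem_filter] at hm ⊢; exact ⟨hm.1, hm.2.2.2⟩
      have hc2 := card_obstructed_le E s n k hL
      have hc3 : (((range n).filter (fun m : ℕ =>
          (fun i : Fin (L + 1) => s ((m : ℤ) + ((i : ℕ) : ℤ))) ∈ E ∧ L + 1 < k ∧ obs m k)).card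
          : ℝ) ≤ ((Bad.card : ℝ) + 1) * (k - (L + 1) : ℕ) := by
        have := hc1.trans hc2
        exact_mod_cast this
      have hk' : ((k - (L + 1) : ℕ) : ℝ) ≤ k := by exact_mod_cast Nat.sub_le k (L + 1)
      have hBn : 0 ≤ (Bad.card : ℝ) + 1 := by positivity
      calc _ ≤ ((Bad.card : ℝ) + 1) * (k - (L + 1) : ℕ) * |J k| :=
            mul_le_mul_of_nonneg_right hc3 (abs_nonneg _)
        _ ≤ ((Bad.card : ℝ) + 1) * k * |J k| := by
            apply mul_le_mul_of_nonneg_right _ (abs_nonneg _)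
            exact mul_le_mul_of_nonneg_left hk' hBn
        _ = _ := by ring
    · rw [if_neg hL]
      have : ∀ m, cost m k = 0 := by
        intro m; simp only [hcost]; rw [if_neg (fun h => hL h.2.1)]
      simp [this]
  have hcost_tot : ∑ m ∈ range n, ∑' k, cost m k ≤ ((Bad.card : ℝ) + 1) * t1 := by
    rw [hexch, ht1, ← Summable.tsum_mul_left]
    · refine Summable.tsum_le_tsum (fun k => ?_) ?_ ?_
      · refine (hcount k).trans (le_of_eq ?_)
        split_ifs <;> ring
      · exact summable_sum fun m _ => hcost_sum m
      · exact (summable_ite_mul_abs hJ _).mul_left _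
    · exact summable_ite_mul_abs hJ _
  nlinarith [hsum, hcost_tot]

end LockedPhaseDefect

end Summit.AtomisticToContinuum.Crystallization.Theorems
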